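import Summits.AtomisticToContinuum.Crystallization.Theorems.OverbindingBudgetLiouvilleDictionary
import Summits.AtomisticToContinuum.Crystallization.Theorems.ChartedPlanarOrderDoorDischarged

/-!
# «DoorLayered» part A of 3 (§1: the EXACT currency — `Layered`, `IsPeriod`, `TwoPeriodic`, `IsLayered`, the dictionary
# `isLayered_iff_twoPeriodic(_of_isSep)`, and §1b non-vacuity) — lens-3 g22 node `DoorLayered.lean` (sha256 8d27d62f…, 972 l) split at the
# 400-line cap by hand-2 g8 (critic row 407 (3)); namespace `…Theorems.ChartedPlanarOrderDoorLayered` UNCHANGED in all three parts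
# (B = `…DoorLayeredNear`, §2; C = `…DoorLayered`, §3–§5).  The node's module text follows verbatim.

# «DoorLayered» — the homogeneity currency of N re-typed: BD charts (currency of record) AND exact two-periodicity (this lens's ONE EQUIV)
(decomp-a2c lens-3 «one certified translation + split beneath», generation 22; blocker N = `ChartedPlanarOrder.ChartedZeroExcessLayered`
(stmt-26636), consumed at its registered conclusions `VisibleGap (1/50) ∧ PertRegime (1/50)` through BULK|door
(`ChartedPlanarOrderMesoCut.BulkDefectGapDoor`, door DISCHARGED by `ChartedPlanarOrderDoorDischarged`, hand-1 g8 p816932);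
written to critic row 399 (2)(3)(8) after lens-4 g28's vacuity theorems (tree `OverbindingBudgetLiouvilleDictionary`, p817239).)

## 0. What was wrong and what this file does about it
The tree currency `NearHom τ r S Q` (module A, p816349) quantifies over an UNRESTRICTED linear chart `L : E3 →L[ℝ] E3`; `L = 0` makes
`LayeredHom 0 w = range w`, so every countable configuration is «near-homogeneous» (`nearHom_of_isSep`, lens-4) and L1′ / HBG♮(u) / K_A / K_B /
K_A² / K_B² of generation 21 are VACUOUS AS TYPED (critic erratum, row 399).  This file
* (A, ordered in row 399 (3)) RE-TYPES the second layer beneath L1′ over the CURRENCY OF RECORD = tree `NearHomBD Λ τ r S Q` (chart an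
  automorphism `L : E3 ≃L[ℝ] E3` with `‖L‖ ≤ Λ ∧ ‖L⁻¹‖ ≤ Λ`, Λ₀ = 2): `NearHomL2BD Λ κ r` (§3), K_A²_BD `CleanScaleCoherenceL2BD Λ κ`,
  K_B²_BD `FlatnessImprovementL2BD Λ κ`, L1′_BD `DoorHomogeneityBD Λ`, the seam `doorHomogeneityBD_of_L2` (PROVED), and — to certify the
  interface with lens-2 g23 — HBG♮(u)_BD `NearHomBulkGapDenseBD` over the SAME tree currency with the HomCut seam `bulkDoor_of_homBD` and
  ★ `gap_and_pert_1_50_of_homBD : DoorHomogeneityBD 2 → NearHomBulkGapDenseBD → VisibleGap (1/50) ∧ PertRegime (1/50)` (§5, PROVED);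
* (NV, standing rule of row 399) ships the NON-VACUITY KERNELS in the same file: (w1) isolated atom — `not_nearHomL2BD_singleton`
  (tree `not_nearHomBD_singleton` transferred through `nearHomBD_of_nearHomL2BD`); (w2) INCOHERENT TWO-PATCH — ★ `not_nearHomBD_of_twoPlane`
  (general: two atoms of `Q` with flat `(Λ+τ)`-neighbourhoods in NON-PARALLEL planes admit no common chart of distortion `≤ Λ` once
  `8Λ³τ < 1`), the concrete instance `twoPatch` (25 + 25 atoms of a horizontal and a vertical unit triangular layer, 10 apart):
  `not_nearHomBD_twoPatch : 0 ≤ τ < 1/64 → 2 ≤ r → ¬ NearHomBD 2 τ r twoPatch {0, c10}`, and the L² versions `not_nearHomL2BD_of_twoPlane`,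
  `not_nearHomL2BD_twoPatch (κ < 1/8192)`; must-fail probes in `bc/probe_layered.lean` (M1–M9 incl. M8: lens-4's `L = 0` witness does NOT
  inhabit the currency of record); and (w0) CALIBRATION (§3c): the trivial regime of the near currencies is marked by theorem —
  `nearHomBD_of_tol_ge` (`τ ≥ r`), `nearHomL2BD_of_large` (`κ ≥ r²`), `cleanScaleCoherenceL2BD_of_large` (K_A²_BD(Λ ≥ 1, κ ≥ 16) is
  trivially true) — so every piece is read below it (K_A²_BD at `κ ≪ 1`; see MEMO-g22-KA2 for where equilibrium-free rigidity lands);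
* (B, the lens's ONE EQUIV) translates the homogeneity MODEL itself into an INTRINSIC statement: for a nonempty countable (e.g. separated)
  configuration, «`S` is a homogeneously strained layered crystal with in-plane generators of length `≤ Λ`» (`IsLayered Λ S :=
  ∃ a b, LinearIndependent ℝ ![a,b] ∧ ‖a‖,‖b‖ ≤ Λ ∧ ∃ w, S = Layered a b w`, and `LayeredHom L w = Layered (L t₁) (L t₂) w`) is EQUIVALENT to
  «`S` has two linearly independent EXACT PERIODS of length `≤ Λ`» (`TwoPeriodic Λ S`): ★ `isLayered_iff_twoPeriodic(_of_isSep)` (PROVED).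
  No chart, no gauge, no tolerance: the degeneracies of every «near» currency (L = 0, L = K·id, scrambled Ψ) have no analogue — a finite set is
  never two-periodic (`not_twoPeriodic_of_finite`, `_singleton`, `not_twoPeriodic_twoPatch`), a single vacancy destroys it
  (`not_twoPeriodic_sdiff_singleton`), every BD `LayeredHom` has it (`twoPeriodic_layeredHom_of_BD`);
* (split beneath, in the exact currency, §4) BULK|door ⟸ L1′♮ `DoorPeriodic Λ` ∧ HBG″ `PeriodicBulkGapDoor Λ`, seam K2″ `bulkDoor_of_periodic`
  (PROVED, modus ponens at the literal `TwoPeriodic Λ S` — `trivial_seam`), K1″ `periodicBulkGapDoor_of_bulkDoor` (HBG″ WEAKER than BULK|door,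
  PROVED), K0″ (BULK ⟹ the Nash-free census face HBG″♭ `PeriodicBulkGap`), and ★ `gap_and_pert_1_50_of_periodic : DoorPeriodic Λ →
  PeriodicBulkGapDoor Λ → VisibleGap (1/50) ∧ PertRegime (1/50)` for EVERY `Λ`; beneath L1′♮: K_A²_BD ∧ K_B²♮ `FlatnessExactL2BD`
  (`doorPeriodic_of_L2`, PROVED), so `gap_and_pert_1_50_of_L2_periodic`.

## 1. The pieces, their tags, why each is weaker than what it replaces
* L1′_BD `DoorHomogeneityBD Λ` [UNDECIDED·XL] — L1′ of row 393 in the currency of record (lens-2 g23 types the same text over its own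
  four-clause currency; one definition at landing, row 400 (2)(b)).  Content: nonlinear discrete Liouville for clean charted LJ equilibria.
* K_A²_BD(Λ,κ) [TRUE?·L, discrete geometric rigidity (Friesecke–James–Müller type) for δ-separated clean windows at radius 4; equilibrium-free]
  and K_B²_BD(Λ,κ) [UNDECIDED·XL, L²-excess decay]: both STRICTLY BELOW L1′_BD only jointly; K_A²_BD ⟸ L1′_BD for κ ≥ 1/256
  (`cleanScaleCoherenceL2BD_of_doorHomogeneityBD`, PROVED).
* HBG♮(u)_BD [ATTACKABLE·L; lens-2 g23 OWNS it and its certificate face TAG 139′ + registry] ⟸ BULK (K0, PROVED).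
* L1′♮ `DoorPeriodic Λ` [UNDECIDED·XL·INSTRUMENTABLE: census TAG 138′ contraction test reads on it directly — an exactly two-periodic door set
  is a layer chain] — STRONGER than L1′_BD modulo the bridge B (§6); INTRINSIC (no chart can degenerate).
* HBG″ `PeriodicBulkGapDoor Λ` [WEAKER than BULK|door: K1″ PROVED; ATTACKABLE·L: on a two-periodic configuration translation by a period is a
  symmetry of `S`, so site energies / matched status are period-invariant and the statement is a LAYER-CHAIN coercivity-with-density statement
  = census TAG 139′ HBC-CERT′ (tree `ChartedPlanarOrderLayerChainLiouville`)]; HBG″♭ `PeriodicBulkGap Λ` its Nash- and chart-free face.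
* K_B²♮ `FlatnessExactL2BD Λ κ` [UNDECIDED·XL]: K_B²_BD's hypothesis, EXACT conclusion (lens-2 N′ schema (iii) «… ⇒ exactly homogeneous»).

## 2. Relations between the two currencies (what is and is not proved here)
MODEL level: a BD `LayeredHom` IS layered/two-periodic (`isLayered_layeredHom_of_BD`, PROVED).  CONFIGURATION level: exact ⇒ near
(`TwoPeriodic Λ S ∧ IsSep δ S ⇒ NearHomBD Λ′(Λ,δ) τ r S S` for every `τ ≥ 0`, chart = the automorphism `e₀ ↦ a, e₁ ↦ (2b−a)/√3, e₂ ↦ unit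
normal`, `‖L⁻¹‖` controlled by the covolume `|a × b| ≥ (√3/2)δ²` of a δ-separated planar lattice) = BRIDGE B, routine 2D lattice geometry, NOT
kernel-proved in this generation; near (∀ τ, r) ⇒ exact: selection/compactness as in the tree precedent
`PeriodPrecisionLadderExactPeriodFromFine.exactPeriodFromFine_proof` — remark only.  Consequently the two third branches of N,
(α) [L1′_BD ∧ HBG♮(u)_BD] (of record) and (β) [L1′♮ ∧ HBG″] (this node), each close N by a PROVED seam; (β)'s seam needs NO chart at all.

## 3. Names used (all tree): `IsDoorSet`, `BulkDefectGapDoor`, `EnvClose`, `LayeredHom`, `isCleanChunk_window`, `bulkDoor_of_bulk`,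
`bulkDoor_of_rigidity` (module A p816349); `NearHomBD`, `not_nearHomBD_singleton`, `norm_triangularVec₁_one` (lens-4 p817239); `BulkDefectGap`,
`IsSep`, `IsCleanChunk`, `excess`, `nBad`, `nBdry`, `nK`, `μS` (p814147); `VisibleGap`, `PertRegime`, `IsClean`, `atomsIn`,
`DiscreteBarlowRigidity` (RigidityDoor); `gap_and_pert_1_50_of_bulkDoor_discharged` (p816932).  `lean check`: rc 0 · 0 err · 0 warn · 0 sorry;
`#print axioms gap_and_pert_1_50_of_periodic / not_nearHomL2BD_twoPatch` = {propext, Classical.choice, Quot.sound}.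
-/

noncomputable section

open MeasureTheory Set Metric
open Summit.AtomisticToContinuum.Crystallization.Theorems.ChartedPlanarOrderRigidityDoor
open Summit.AtomisticToContinuum.Crystallization.Theorems.ChartedPlanarOrderDensityDichotomy
open Summit.AtomisticToContinuum.Crystallization.Theorems.ChartedPlanarOrderMesoCut
open Summit.AtomisticToContinuum.Crystallization.Theorems.OverbindingBudgetLiouvilleDictionary
  (NearHomBD not_nearHomBD_singleton nearHom_of_nearHomBD norm_triangularVec₁_one countable_of_isSep)
open Literature.MathematicalPhysics.StatisticalMechanics (triangularVec₁ triangularVec₂)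

namespace Summit.AtomisticToContinuum.Crystallization.Theorems.ChartedPlanarOrderDoorLayered

/-! ## 1. The exact currency: layered structures in gauge-free form, periods, and THE dictionary -/

/-- the layered structure generated IN-PLANE by `a, b`, layer `m` translated by the free vector `w m`
(gauge-free form of the tree's `LayeredHom L w`: only `L t₁ = a`, `L t₂ = b` are ever seen, `layeredHom_eq_layered`). -/
def Layered (a b : E3) (w : ℤ → E3) : Set E3 :=
  {p | ∃ m i j : ℤ, p = ((i : ℝ) • a + (j : ℝ) • b) + w m}

/-- the tree's chart family in gauge-free form. -/
theorem layeredHom_eq_layered (L : E3 →L[ℝ] E3) (w : ℤ → E3) :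
    LayeredHom L w = Layered (L (triangularVec₁ 1)) (L (triangularVec₂ 1)) w := by
  ext p
  simp only [LayeredHom, Layered, Set.mem_setOf_eq, map_add, map_smul]

/-- `v` is an (exact) PERIOD of `S`. -/
def IsPeriod (S : Set E3) (v : E3) : Prop := ∀ p : E3, p + v ∈ S ↔ p ∈ S

/-- **TwoPeriodic Λ S** (INTRINSIC): `S` has two linearly independent exact periods of length `≤ Λ`. -/
def TwoPeriodic (Λ : ℝ) (S : Set E3) : Prop :=
  ∃ a b : E3, LinearIndependent ℝ ![a, b] ∧ ‖a‖ ≤ Λ ∧ ‖b‖ ≤ Λ ∧ IsPeriod S a ∧ IsPeriod S b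

/-- **IsLayered Λ S** (EXTRINSIC, the model family): `S` IS a layered structure with independent in-plane generators of length `≤ Λ`. -/
def IsLayered (Λ : ℝ) (S : Set E3) : Prop :=
  ∃ a b : E3, LinearIndependent ℝ ![a, b] ∧ ‖a‖ ≤ Λ ∧ ‖b‖ ≤ Λ ∧ ∃ w : ℤ → E3, S = Layered a b w

/-- `0` is a period of every set. [folklore] -/
theorem IsPeriod.zero (S : Set E3) : IsPeriod S 0 := fun p => by rw [add_zero]

/-- The negative of a period is a period. [folklore] -/
theorem IsPeriod.neg {S : Set E3} {v : E3} (h : IsPeriod S v) : IsPeriod S (-v) := fun p => by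
  have := h (p + -v)
  rw [neg_add_cancel_right] at this
  exact this.symm

/-- integer multiples of a period are periods. -/
theorem IsPeriod.zsmul_mem {S : Set E3} {v : E3} (h : IsPeriod S v) (i : ℤ) (p : E3) : p + (i : ℝ) • v ∈ S ↔ p ∈ S := by
  induction i generalizing p with
  | zero => simp
  | succ i ih =>
    have e : p + (((i : ℤ) + 1 : ℤ) : ℝ) • v = (p + ((i : ℤ) : ℝ) • v) + v := by
      push_cast
      rw [add_smul, one_smul, add_assoc]
    rw [e, h, ih]
  | pred i ih =>
    have e : (p + ((-(i : ℤ) - 1 : ℤ) : ℝ) • v) + v = p + ((-(i : ℤ) : ℤ) : ℝ) • v := by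
      push_cast
      rw [sub_smul, one_smul, add_assoc, sub_add_cancel]
    rw [← ih p, ← e, h]

/-- the first in-plane generator is a period of a layered structure … -/
theorem isPeriod_layered_fst (a b : E3) (w : ℤ → E3) : IsPeriod (Layered a b w) a := by
  intro p
  constructor
  · rintro ⟨m, i, j, h⟩
    refine ⟨m, i - 1, j, ?_⟩
    have : p = ((i : ℝ) • a + (j : ℝ) • b) + w m - a := by rw [← h, add_sub_cancel_right]
    rw [this]
    push_cast
    rw [sub_smul, one_smul]
    abel
  · rintro ⟨m, i, j, rfl⟩
    refine ⟨m, i + 1, j, ?_⟩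
    push_cast
    rw [add_smul, one_smul]
    abel

/-- … and so is the second. -/
theorem isPeriod_layered_snd (a b : E3) (w : ℤ → E3) : IsPeriod (Layered a b w) b := by
  intro p
  constructor
  · rintro ⟨m, i, j, h⟩
    refine ⟨m, i, j - 1, ?_⟩
    have : p = ((i : ℝ) • a + (j : ℝ) • b) + w m - b := by rw [← h, add_sub_cancel_right]
    rw [this]
    push_cast
    rw [sub_smul, one_smul]
    abel
  · rintro ⟨m, i, j, rfl⟩
    refine ⟨m, i, j + 1, ?_⟩
    push_cast
    rw [add_smul, one_smul]
    abel

/-- the layer representatives lie in the structure. -/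
theorem mem_layered_w (a b : E3) (w : ℤ → E3) (m : ℤ) : w m ∈ Layered a b w :=
  ⟨m, 0, 0, by simp⟩

/-- ★ **THE DICTIONARY (the node's one EQUIV), direction model ⇒ intrinsic:** a layered structure is two-periodic (same generators). -/
theorem twoPeriodic_of_isLayered {Λ : ℝ} {S : Set E3} (h : IsLayered Λ S) : TwoPeriodic Λ S := by
  obtain ⟨a, b, hab, ha, hb, w, rfl⟩ := h
  exact ⟨a, b, hab, ha, hb, isPeriod_layered_fst a b w, isPeriod_layered_snd a b w⟩

/-- ★ **THE DICTIONARY, direction intrinsic ⇒ model:** a countable non-empty two-periodic set IS a layered structure (same generators; the layer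
representatives `w` enumerate `S` itself — repetitions are harmless in a union). -/
theorem isLayered_of_twoPeriodic {Λ : ℝ} {S : Set E3} (hne : S.Nonempty) (hc : S.Countable) (h : TwoPeriodic Λ S) : IsLayered Λ S := by
  obtain ⟨a, b, hab, ha, hb, hpa, hpb⟩ := h
  obtain ⟨f, hf⟩ := hc.exists_eq_range hne
  refine ⟨a, b, hab, ha, hb, fun m => f m.toNat, Set.Subset.antisymm ?_ ?_⟩
  · intro p hp
    rw [hf] at hp
    obtain ⟨n, rfl⟩ := hp
    exact ⟨(n : ℤ), 0, 0, by simp⟩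
  · rintro p ⟨m, i, j, rfl⟩
    have hw : f m.toNat ∈ S := by rw [hf]; exact Set.mem_range_self _
    have h1 : f m.toNat + (j : ℝ) • b ∈ S := (hpb.zsmul_mem j _).2 hw
    have h2 : (f m.toNat + (j : ℝ) • b) + (i : ℝ) • a ∈ S := (hpa.zsmul_mem i _).2 h1
    have e : ((i : ℝ) • a + (j : ℝ) • b) + f m.toNat = (f m.toNat + (j : ℝ) • b) + (i : ℝ) • a := by abel
    rw [e]
    exact h2

/-- ★ **EQUIV (certified both ways):** for countable non-empty `S` (every separated configuration is), `IsLayered Λ S ↔ TwoPeriodic Λ S`. -/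
theorem isLayered_iff_twoPeriodic {Λ : ℝ} {S : Set E3} (hne : S.Nonempty) (hc : S.Countable) : IsLayered Λ S ↔ TwoPeriodic Λ S :=
  ⟨twoPeriodic_of_isLayered, isLayered_of_twoPeriodic hne hc⟩

/-- the separated (door) reading of the EQUIV. -/
theorem isLayered_iff_twoPeriodic_of_isSep {Λ δ : ℝ} (hδ : 0 < δ) {S : Set E3} (h0 : (0 : E3) ∈ S) (hS : IsSep δ S) :
    IsLayered Λ S ↔ TwoPeriodic Λ S :=
  isLayered_iff_twoPeriodic ⟨0, h0⟩ (countable_of_isSep hδ hS)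

/-! ### 1b. Non-vacuity of the exact currency (lens-4's tests (w1)(w2) and more, as theorems) -/

/-- a set with a non-zero period through one of its points is infinite. -/
theorem infinite_of_isPeriod {S : Set E3} {v : E3} (hv : v ≠ 0) (h : IsPeriod S v) {p : E3} (hp : p ∈ S) : S.Infinite := by
  refine Set.infinite_of_injective_forall_mem (f := fun i : ℤ => p + (i : ℝ) • v) ?_ (fun i => (h.zsmul_mem i p).2 hp)
  intro i j hij
  have h1 : (i : ℝ) • v = (j : ℝ) • v := add_left_cancel hij
  have h2 : ((i : ℝ) - (j : ℝ)) • v = 0 := by rw [sub_smul, h1, sub_self]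
  rcases smul_eq_zero.1 h2 with h3 | h3
  · exact_mod_cast sub_eq_zero.1 h3
  · exact absurd h3 hv

/-- a two-periodic set containing a point is infinite … -/
theorem infinite_of_twoPeriodic {Λ : ℝ} {S : Set E3} (h : TwoPeriodic Λ S) (hne : S.Nonempty) : S.Infinite := by
  obtain ⟨a, b, hab, -, -, hpa, -⟩ := h
  obtain ⟨p, hp⟩ := hne
  have ha : a ≠ 0 := by
    have := hab.ne_zero 0
    simpa using this
  exact infinite_of_isPeriod ha hpa hp

/-- … so **(w1) and every FINITE configuration (an isolated atom, a finite cluster, any finite union of finite patches) is NOT two-periodic**. -/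
theorem not_twoPeriodic_of_finite {Λ : ℝ} {S : Set E3} (hS : S.Finite) (hne : S.Nonempty) : ¬ TwoPeriodic Λ S :=
  fun h => infinite_of_twoPeriodic h hne hS

/-- A singleton is not two-periodic. [folklore] -/
theorem not_twoPeriodic_singleton (Λ : ℝ) (x : E3) : ¬ TwoPeriodic Λ {x} :=
  not_twoPeriodic_of_finite (Set.finite_singleton x) (Set.singleton_nonempty x)

/-- A finite nonempty set is not layered. [folklore] -/
theorem not_isLayered_of_finite {Λ : ℝ} {S : Set E3} (hS : S.Finite) (hne : S.Nonempty) : ¬ IsLayered Λ S :=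
  fun h => not_twoPeriodic_of_finite hS hne (twoPeriodic_of_isLayered h)

/-- **(w3) a MONO-VACANCY kills two-periodicity**: removing one atom `v` from a set with some non-zero period `γ` leaves a set with NO
two independent short periods (indeed with no non-zero period at all along which `v + γ` could be translated back onto `v`). -/
theorem not_twoPeriodic_sdiff_singleton {Λ : ℝ} {S : Set E3} {v γ : E3} (hv : v ∈ S) (hγ : γ ≠ 0) (hγS : IsPeriod S γ) :
    ¬ TwoPeriodic Λ (S \ {v}) := by
  rintro ⟨a, b, hab, -, -, hpa, -⟩
  have ha : a ≠ 0 := by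
    have := hab.ne_zero 0
    simpa using this
  -- `v + γ ∈ S \ {v}`; translate it by the multiples of `a` and by `-γ`
  have hvγ : v + γ ∈ S \ {v} := by
    refine ⟨(hγS v).2 hv, fun h => hγ ?_⟩
    have : v + γ = v + 0 := by rw [add_zero]; exact h
    exact add_left_cancel this
  -- all `v + γ + i a` lie in `S \ {v}`, hence `v + i a ∈ S` for all `i`; and `v + a ∈ S \ {v}` unless `a = 0`… use the period `a` at `p := v`:
  have h1 : v + a ∈ S \ {v} ↔ v ∈ S \ {v} := hpa v
  have h2 : v ∉ S \ {v} := fun h => h.2 rfl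
  have h3 : v + a ∉ S \ {v} := fun h => h2 (h1.1 h)
  -- but `v + a = (v + γ + a) - γ` with `v + γ + a ∈ S \ {v}`:
  have h4 : v + γ + a ∈ S \ {v} := (hpa (v + γ)).2 hvγ
  have h5 : v + a ∈ S := by
    have := (hγS (v + a)).1
    apply this
    have e : v + a + γ = v + γ + a := by abel
    rw [e]; exact h4.1
  have h6 : v + a ≠ v := by
    intro h
    have : v + a = v + 0 := by rw [add_zero]; exact h
    exact ha (add_left_cancel this)
  exact h3 ⟨h5, h6⟩

/-- richness: every layered structure with independent short generators IS two-periodic (e.g. every homogeneously strained Barlow stacking). -/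
theorem twoPeriodic_layered {Λ : ℝ} {a b : E3} (hab : LinearIndependent ℝ ![a, b]) (ha : ‖a‖ ≤ Λ) (hb : ‖b‖ ≤ Λ) (w : ℤ → E3) :
    TwoPeriodic Λ (Layered a b w) :=
  twoPeriodic_of_isLayered ⟨a, b, hab, ha, hb, w, rfl⟩

/-- monotonicity in `Λ`. -/
theorem TwoPeriodic.mono {Λ Λ' : ℝ} (hΛ : Λ ≤ Λ') {S : Set E3} (h : TwoPeriodic Λ S) : TwoPeriodic Λ' S := by
  obtain ⟨a, b, hab, ha, hb, hpa, hpb⟩ := h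
  exact ⟨a, b, hab, ha.trans hΛ, hb.trans hΛ, hpa, hpb⟩

end Summit.AtomisticToContinuum.Crystallization.Theorems.ChartedPlanarOrderDoorLayered

end
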